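import Mathlib.Geometry.Manifold.PartitionOfUnity
import Mathlib.Analysis.Normed.Operator.BoundedLinearMaps
import Literature.Topology.Immersions.HolonomicApproximationSegment
import HarnessLib

/-!
# Extending a formal submersion of `ℝⁿ⁺²` over a segment (the `1`-handle step, Euclidean form)

Topic `Literature/Topology/Immersions`; the Euclidean core of the step "handle of index `1`" in
the Gromov–Eliashberg–Mishachev route to Phillips' submersion theorem
(`Literature.Topology.Immersions.Phillips1967_exists_isLocalDiffeomorph_of_isParallelizable`).
A *formal submersion* of an open set `O ⊆ ℝⁿ⁺²` is a pair `(f, A)` of a `C^∞` map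
`f : ℝⁿ⁺² → ℝⁿ⁺²` and a continuous field `A : O → GL(ℝⁿ⁺²)`; it is *holonomic* on `W` if
`Df = A` there. We prove: if `(f, A)` is holonomic on an open `W ⊇ Û`, `Û` closed, and the core
segment `C = c([0, 1])` lies in `O` with its end points in `Û` and `C ∩ Û ⊆ {c(0), c(1)}`, then
for every `ρ > 0` (with `cthickening ρ C ⊆ O`) there is a formal submersion `(g, A')` of `O`,
equal to `(f, A)` off the `ρ`-tube of `C`, and holonomic on an open set containing `Û ∪ C`
(Eliashberg–Mishachev 2001, §2.1, proof of Gromov's theorem 2.1.2, for one cell: holonomic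
approximation near the wiggled core `h(C)` (`holonomicApproximation_segment`), openness of the
submersion relation, pull-back by the shear `h` (`Diff`-invariance), and a straight-line
transport of the formal derivative along the shear isotopy `h_s = shear (s φ_N)`).

* `Literature.Topology.Immersions.exists_forall_isInvertible_of_norm_sub_lt` — uniform openness of
  invertibility along a compact family.
* `Literature.Topology.Immersions.shearFDeriv` — the derivative `id + s φ'(x₀) e₁ ⊗ e₀*` of the
  partial shears, an invertible map depending continuously on `(s, x)`.
* `Literature.Topology.Immersions.exists_contDiff_zero_one_of_isClosed` — smooth Urysohn functions
  on `ℝⁿ⁺²` (Mathlib's manifold version specialised).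
* `Literature.Topology.Immersions.exists_thickening_inter_subset` — thin tubes about the core meet a
  closed set touching the core only at its end points inside prescribed end regions.
* `Literature.Topology.Immersions.exists_holonomic_extension_segment` — the theorem.

## References

* Y. Eliashberg, N. Mishachev, *Holonomic approximation and Gromov's h-principle*,
  arXiv:math/0101196 (2001), §2.1 (proof of Thm. 2.1.2), Thm. 1.3.1. [EliashbergMishachev2001]
* A. Phillips, *Submersions of open manifolds*, Topology **6** (1967), Lemma 4.1 (handles of
  index `< n`), §6. [Phillips1967]
-/

open Set Function Filter Metric Real
open scoped Topology ContDiff Manifold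

noncomputable section

namespace Literature.Topology.Immersions

variable {n : ℕ}

/-- Local notation: the model space `ℝⁿ⁺²`. -/
local notation "𝔼₂" => EuclideanSpace ℝ (Fin (n + 2))

/-! ### Uniform openness of invertibility -/

/-- **Invertibility is uniformly open along a compact family.** If `A` is continuous on a set
containing the compact set `K` and `A y` is invertible for `y ∈ K`, there is `ε₁ > 0` such that
every continuous linear map within `ε₁` of some `A y`, `y ∈ K`, is invertible (the invertible
maps form an open set, `ContinuousLinearEquiv.isOpen`, at positive distance from the compact
image `A '' K`). [folklore] -/
theorem exists_forall_isInvertible_of_norm_sub_lt {X : Type*} [TopologicalSpace X]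
    {E : Type*} [NormedAddCommGroup E] [NormedSpace ℝ E] [CompleteSpace E] {A : X → E →L[ℝ] E}
    {K : Set X} (hK : IsCompact K) (hA : ContinuousOn A K) (hinv : ∀ y ∈ K, (A y).IsInvertible) :
    ∃ ε₁ > 0, ∀ y ∈ K, ∀ B : E →L[ℝ] E, ‖B - A y‖ < ε₁ → B.IsInvertible := by
  have himg : IsCompact (A '' K) := hK.image_of_continuousOn hA
  have hopen : IsOpen (range ((↑) : (E ≃L[ℝ] E) → E →L[ℝ] E)) := ContinuousLinearEquiv.isOpen
  have hsub : A '' K ⊆ range ((↑) : (E ≃L[ℝ] E) → E →L[ℝ] E) := by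
    rintro _ ⟨y, hy, rfl⟩
    obtain ⟨e, he⟩ := hinv y hy
    exact ⟨e, he⟩
  obtain ⟨ε₁, hε₁, hthick⟩ := himg.exists_cthickening_subset_open hopen hsub
  refine ⟨ε₁, hε₁, fun y hy B hB => ?_⟩
  have hmem : B ∈ cthickening ε₁ (A '' K) :=
    thickening_subset_cthickening _ _ (mem_thickening_iff.2 ⟨A y, mem_image_of_mem _ hy,
      by rwa [dist_eq_norm]⟩)
  obtain ⟨e, he⟩ := hthick hmem
  exact ⟨e, he⟩

/-! ### The derivative of the partial shears -/

/-- The derivative of the shear `x ↦ x + s φ(x₀) e₁` at `x`: `id + (s φ'(x₀)) e₁ ⊗ e₀*`.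
[cite: EliashbergMishachev2001, Thm. 1.3.1] -/
def shearFDeriv (φ : ℝ → ℝ) (s : ℝ) (x : EuclideanSpace ℝ (Fin (n + 2))) :
    EuclideanSpace ℝ (Fin (n + 2)) →L[ℝ] EuclideanSpace ℝ (Fin (n + 2)) :=
  ContinuousLinearMap.id ℝ _ +
    (s * deriv φ (x 0)) • ((EuclideanSpace.proj (0 : Fin (n + 2)) : 𝔼₂ →L[ℝ] ℝ).smulRight
      (EuclideanSpace.single (1 : Fin (n + 2)) (1 : ℝ)))

/-- `(c • ℓ) ⊗ v = c • (ℓ ⊗ v)` for rank-one operators. [folklore] -/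
theorem smul_smulRight_eq {E F : Type*} [NormedAddCommGroup E] [NormedSpace ℝ E]
    [NormedAddCommGroup F] [NormedSpace ℝ F] (c : ℝ) (ℓ : E →L[ℝ] ℝ) (v : F) :
    (c • ℓ).smulRight v = c • ℓ.smulRight v := by
  ext w
  simp [ContinuousLinearMap.smulRight_apply, mul_smul]

/-- `0 • X = 0` for continuous linear maps of `ℝⁿ⁺²` (recorded because the scalar action on
`ℝⁿ⁺² →L ℝⁿ⁺²` reaches `simp` through two instance paths). [folklore] -/
theorem zero_smul_clm (X : 𝔼₂ →L[ℝ] 𝔼₂) : (0 : ℝ) • X = 0 := by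
  ext v
  simp

/-- The rank-one part `N = c • e₁ ⊗ e₀*` of the shear derivative squares to zero (`e₀*(e₁) = 0`).
[folklore] -/
theorem smulRight_single_apply_single (c : ℝ) (v : 𝔼₂) :
    (c • ((EuclideanSpace.proj (0 : Fin (n + 2)) : 𝔼₂ →L[ℝ] ℝ).smulRight
      (EuclideanSpace.single (1 : Fin (n + 2)) (1 : ℝ))))
      ((c • ((EuclideanSpace.proj (0 : Fin (n + 2)) : 𝔼₂ →L[ℝ] ℝ).smulRight
        (EuclideanSpace.single (1 : Fin (n + 2)) (1 : ℝ)))) v) = 0 := by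
  simp [ContinuousLinearMap.smulRight_apply]

/-- **The shear derivative is invertible**, with inverse `id - N` (`N² = 0`). [folklore] -/
theorem isInvertible_shearFDeriv (φ : ℝ → ℝ) (s : ℝ) (x : 𝔼₂) :
    (shearFDeriv φ s x).IsInvertible := by
  set N : 𝔼₂ →L[ℝ] 𝔼₂ := (s * deriv φ (x 0)) •
    ((EuclideanSpace.proj (0 : Fin (n + 2)) : 𝔼₂ →L[ℝ] ℝ).smulRight
      (EuclideanSpace.single (1 : Fin (n + 2)) (1 : ℝ))) with hN
  have hN2 : ∀ v, N (N v) = 0 := fun v => smulRight_single_apply_single _ v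
  have h1 : ∀ v, (ContinuousLinearMap.id ℝ 𝔼₂ + N) ((ContinuousLinearMap.id ℝ 𝔼₂ - N) v) = v := by
    intro v
    simp only [add_apply, sub_apply,
      ContinuousLinearMap.id_apply, map_sub, hN2]
    abel
  have h2 : ∀ v, (ContinuousLinearMap.id ℝ 𝔼₂ - N) ((ContinuousLinearMap.id ℝ 𝔼₂ + N) v) = v := by
    intro v
    simp only [add_apply, sub_apply, ContinuousLinearMap.id_apply, map_add, hN2]
    abel
  refine ⟨ContinuousLinearEquiv.equivOfInverse (ContinuousLinearMap.id ℝ 𝔼₂ + N)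
    (ContinuousLinearMap.id ℝ 𝔼₂ - N) h2 h1, ?_⟩
  ext v
  rfl

/-- The shear derivative is the derivative of the shear by `s • φ`. [folklore] -/
theorem hasFDerivAt_shear_smul {φ : ℝ → ℝ} (hφ : ContDiff ℝ ∞ φ) (s : ℝ) (x : 𝔼₂) :
    HasFDerivAt (shear (fun t => s * φ t) 0 1) (shearFDeriv φ s x) x := by
  have hd : HasDerivAt (fun t => s * φ t) (s * deriv φ (x 0)) (x 0) :=
    ((hφ.differentiable (by simp)) _).hasDerivAt.const_mul s
  have h := hasFDerivAt_shear (i := 0) (j := 1) hd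
  rwa [smul_smulRight_eq] at h

/-- With `s = 0` or where `φ' (x₀) = 0`, the shear derivative is the identity. [folklore] -/
theorem shearFDeriv_of_mul_eq_zero {φ : ℝ → ℝ} {s : ℝ} {x : 𝔼₂} (h : s * deriv φ (x 0) = 0) :
    shearFDeriv φ s x = ContinuousLinearMap.id ℝ _ := by
  ext v
  simp [shearFDeriv, h]

/-- The shear derivative depends continuously on `(s, x)` (`φ` of class `C¹`). [folklore] -/
theorem continuous_shearFDeriv {φ : ℝ → ℝ} (hφ : ContDiff ℝ ∞ φ) :
    Continuous fun q : ℝ × 𝔼₂ => shearFDeriv φ q.1 q.2 := by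
  unfold shearFDeriv
  refine continuous_const.add ?_
  have hc0 : Continuous fun q : ℝ × 𝔼₂ => q.2 0 :=
    (EuclideanSpace.proj (0 : Fin (n + 2)) : 𝔼₂ →L[ℝ] ℝ).continuous.comp continuous_snd
  have hcoef : Continuous fun q : ℝ × 𝔼₂ => q.1 * deriv φ (q.2 0) :=
    continuous_fst.mul ((hφ.continuous_deriv (by simp)).comp hc0)
  exact hcoef.smul continuous_const

/-! ### Smooth Urysohn functions on `ℝⁿ⁺²` -/

/-- **Smooth Urysohn functions on `ℝⁿ⁺²`**: for disjoint closed sets `s`, `t` there is a `C^∞`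
function `χ : ℝⁿ⁺² → [0, 1]` with `χ = 0` on `s` and `χ = 1` on `t` (Mathlib's
`exists_contMDiffMap_zero_one_of_isClosed` on the manifold `ℝⁿ⁺²`). [folklore] -/
theorem exists_contDiff_zero_one_of_isClosed {s t : Set 𝔼₂} (hs : IsClosed s) (ht : IsClosed t)
    (hd : Disjoint s t) :
    ∃ χ : 𝔼₂ → ℝ, ContDiff ℝ ∞ χ ∧ EqOn χ 0 s ∧ EqOn χ 1 t ∧ ∀ x, χ x ∈ Icc (0 : ℝ) 1 := by
  obtain ⟨f, hf0, hf1, hf01⟩ :=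
    exists_contMDiffMap_zero_one_of_isClosed 𝓘(ℝ, 𝔼₂) (n := (⊤ : ℕ∞)) hs ht hd
  exact ⟨fun x => f x, contMDiff_iff_contDiff.1 f.contMDiff, hf0, hf1, hf01⟩

/-! ### Thin tubes about the core -/

/-- **Thin tubes meet a closed set touching the core only at its ends inside the end regions.**
Let `Û` be closed with `Û ∩ C ⊆ {c(0), c(1)}`, `C = c([0, 1])` the core segment, and let `E`
be an open set containing `c(0)` and `c(1)`. Then some closed tube `cthickening κ C`, `κ > 0`,
meets `Û` inside `E`. (Compactness: otherwise points of `Û ∖ E` accumulate on `C`.)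
[folklore] -/
theorem exists_cthickening_inter_subset {U E : Set 𝔼₂} (hU : IsClosed U)
    (hUC : U ∩ coreLine n '' Icc 0 1 ⊆ {coreLine n 0, coreLine n 1}) (hE : IsOpen E)
    (h0 : coreLine n 0 ∈ E) (h1 : coreLine n 1 ∈ E) :
    ∃ κ > 0, U ∩ cthickening κ (coreLine n '' Icc 0 1) ⊆ E := by
  -- the compact set `C` and the closed set `U \ E` are disjoint, hence at positive distance
  have hC : IsCompact (coreLine n '' Icc (0 : ℝ) 1) := isCompact_Icc.image continuous_coreLine
  have hUE : IsClosed (U \ E) := hU.sdiff hE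
  have hdisj : Disjoint (coreLine n '' Icc (0 : ℝ) 1) (U \ E) := by
    rw [disjoint_left]
    rintro y hyC ⟨hyU, hyE⟩
    have := hUC ⟨hyU, hyC⟩
    rcases this with rfl | rfl
    · exact hyE h0
    · exact hyE h1
  obtain ⟨κ, hκ, hthick⟩ := hC.exists_cthickening_subset_open hUE.isOpen_compl
    (subset_compl_iff_disjoint_right.2 hdisj)
  refine ⟨κ, hκ, fun y ⟨hyU, hyC⟩ => ?_⟩
  by_contra hyE
  exact hthick hyC ⟨hyU, hyE⟩

/-! ### Small metric helpers -/

/-- A point within `d` of a point of the `a`-thickening lies in the `(a + d)`-thickening.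
[folklore] -/
theorem mem_thickening_add_of_dist_le {X : Type*} [PseudoMetricSpace X] {S : Set X} {a d : ℝ}
    {y z : X} (hy : y ∈ thickening a S) (hz : dist z y ≤ d) : z ∈ thickening (a + d) S := by
  rw [mem_thickening_iff] at hy ⊢
  obtain ⟨p, hp, hyp⟩ := hy
  exact ⟨p, hp, by linarith [dist_triangle z y p]⟩

/-- A point within `d` of a point of the closed `a`-thickening lies in the `(a + d')`-thickening
for any `d' > d` (`0 ≤ a`). [folklore] -/
theorem mem_thickening_of_mem_cthickening_of_dist_le {X : Type*} [PseudoMetricSpace X]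
    {S : Set X} {a d d' : ℝ} (ha : 0 ≤ a) (hd : d < d') {y z : X} (hy : y ∈ cthickening a S)
    (hz : dist z y ≤ d) : z ∈ thickening (a + d') S := by
  have hy' : y ∈ thickening (a + (d' - d)) S :=
    cthickening_subset_thickening' (by linarith) (by linarith) S hy
  have := mem_thickening_add_of_dist_le hy' hz
  convert this using 2
  ring

/-- The wiggle has vanishing derivative left of `1/(8N)`. [folklore] -/
theorem deriv_wiggle_of_lt {N : ℕ} (hN : 0 < N) (δ₁ : ℝ) {t : ℝ} (ht : t < 1 / (8 * N)) :
    deriv (wiggle N δ₁) t = 0 := by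
  have h : wiggle N δ₁ =ᶠ[𝓝 t] fun _ => (0 : ℝ) :=
    Filter.eventuallyEq_of_mem (Iio_mem_nhds ht) fun u hu => wiggle_of_le hN δ₁ (le_of_lt hu)
  rw [h.deriv_eq, deriv_const]

/-- The wiggle has vanishing derivative right of `1 - 1/(8N)`. [folklore] -/
theorem deriv_wiggle_of_gt {N : ℕ} (hN : 0 < N) (δ₁ : ℝ) {t : ℝ} (ht : 1 - 1 / (8 * N) < t) :
    deriv (wiggle N δ₁) t = 0 := by
  have h : wiggle N δ₁ =ᶠ[𝓝 t] fun _ => (0 : ℝ) :=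
    Filter.eventuallyEq_of_mem (Ioi_mem_nhds ht) fun u hu => wiggle_of_ge hN δ₁ (le_of_lt hu)
  rw [h.deriv_eq, deriv_const]

/-! ### The extension theorem -/

/-- **Extending a formal submersion of `ℝⁿ⁺²` over a segment** (the `1`-handle step of the
`h`-principle for submersions, Euclidean form: Eliashberg–Mishachev 2001, §2.1, proof of Thm.
2.1.2 for one `1`-cell; Phillips 1967, Lemma 4.1 with `λ = 1`). Let `O ⊆ ℝⁿ⁺²` be open,
`f : ℝⁿ⁺² → ℝⁿ⁺²` a `C^∞` map and `A` a field of invertible continuous linear maps, continuous on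
`O`, with `Df = A` on an open set `W`, `Û ⊆ W ⊆ O`, `Û` closed. Let the core segment
`C = c([0, 1])` have its closed `ρ`-tube in `O`, its end points in `Û`, and meet `Û` only at
its end points. Then there are a `C^∞` map `g`, a field `A'` of invertible maps continuous on `O`,
and an open set `W'` with `Û ∪ C ⊆ W' ⊆ O` such that `Dg = A'` on `W'`, and `(g, A') = (f, A)`
off the open `ρ`-tube of `C`. Construction: `g̃` a holonomic `ε₁/2`-approximation of `(f, A)`
near the wiggled core `h(C)` equal to `f` near the ends (`holonomicApproximation_segment`,
`ε₁` an invertibility margin of `A` near `C`), `ĝ = g̃ ∘ h` (a submersion near `C` by openness),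
`g = f + χ (ĝ - f)`, and
`A' = [(1 - μ) A ∘ h_λ + μ Dg̃ ∘ h_λ] ∘ D(h_λ)`, `h_s` the shear by `s φ_N`, for nested cut-offs
`χ ≺ μ ≺ λ` supported in thin tubes of `C`. [cite: EliashbergMishachev2001, §2.1] -/
theorem exists_holonomic_extension_segment {O : Set 𝔼₂} (hO : IsOpen O) {f : 𝔼₂ → 𝔼₂}
    (hf : ContDiff ℝ ∞ f) {A : 𝔼₂ → 𝔼₂ →L[ℝ] 𝔼₂} (hA : ContinuousOn A O)
    (hinv : ∀ y ∈ O, (A y).IsInvertible) {U W : Set 𝔼₂} (hU : IsClosed U) (hW : IsOpen W)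
    (hUW : U ⊆ W) (hWO : W ⊆ O) (hhol : ∀ y ∈ W, fderiv ℝ f y = A y) {ρ : ℝ} (hρ : 0 < ρ)
    (hρO : cthickening ρ (coreLine n '' Icc 0 1) ⊆ O) (h0 : coreLine n 0 ∈ U)
    (h1 : coreLine n 1 ∈ U) (hUC : U ∩ coreLine n '' Icc 0 1 ⊆ {coreLine n 0, coreLine n 1}) :
    ∃ (g : 𝔼₂ → 𝔼₂) (A' : 𝔼₂ → 𝔼₂ →L[ℝ] 𝔼₂) (W' : Set 𝔼₂), ContDiff ℝ ∞ g ∧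
      ContinuousOn A' O ∧ (∀ y ∈ O, (A' y).IsInvertible) ∧ IsOpen W' ∧
      U ∪ coreLine n '' Icc 0 1 ⊆ W' ∧ W' ⊆ O ∧ (∀ y ∈ W', fderiv ℝ g y = A' y) ∧
      ∀ y ∉ thickening ρ (coreLine n '' Icc 0 1), g y = f y ∧ A' y = A y := by
  set C : Set 𝔼₂ := coreLine n '' Icc 0 1 with hC
  have hCc : IsCompact C := isCompact_Icc.image continuous_coreLine
  have h0C : coreLine n 0 ∈ C := mem_image_of_mem _ ⟨le_rfl, zero_le_one⟩
  have h1C : coreLine n 1 ∈ C := mem_image_of_mem _ ⟨zero_le_one, le_rfl⟩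
  -- S1: the compact tube `K` and the invertibility margin `ε₁`
  set K : Set 𝔼₂ := cthickening (ρ / 2) C with hK
  have hKc : IsCompact K := hCc.cthickening
  have hKρ : K ⊆ thickening ρ C := cthickening_subset_thickening' hρ (by linarith) C
  have hKO : K ⊆ O := (cthickening_mono (by linarith) C).trans hρO
  have hCK : thickening (ρ / 2) C ⊆ K := thickening_subset_cthickening _ _
  obtain ⟨ε₁, hε₁, hmargin⟩ := exists_forall_isInvertible_of_norm_sub_lt hKc (hA.mono hKO)
    fun y hy => hinv y (hKO hy)
  -- S2: a globally continuous field `A_ext = χ_A • A`, equal to `A` on `K`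
  obtain ⟨χA, hχA, hχA0, hχA1, hχA01⟩ := exists_contDiff_zero_one_of_isClosed
    (isOpen_thickening (δ := ρ) (E := C)).isClosed_compl isClosed_cthickening
    (disjoint_compl_left_iff_subset.2 hKρ)
  set Aext : 𝔼₂ → 𝔼₂ →L[ℝ] 𝔼₂ := fun y => χA y • A y with hAext
  have hAext_cont : Continuous Aext := by
    have htsupp : tsupport χA ⊆ cthickening ρ C := by
      refine closure_minimal (fun y hy => ?_) isClosed_cthickening
      by_contra hy'
      exact hy (hχA0 (fun h => hy' (thickening_subset_cthickening _ _ h)))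
    have h_on : ContinuousOn Aext O := hχA.continuous.continuousOn.smul hA
    have h_off : ContinuousOn Aext (tsupport χA)ᶜ := by
      refine (continuousOn_const (c := (0 : 𝔼₂ →L[ℝ] 𝔼₂))).congr fun y hy => ?_
      show χA y • A y = 0
      rw [image_eq_zero_of_notMem_tsupport hy]
      exact zero_smul_clm _
    have hunion : O ∪ (tsupport χA)ᶜ = univ := by
      refine eq_univ_of_forall fun y => ?_
      by_cases hy : y ∈ tsupport χA
      · exact Or.inl (hρO (htsupp hy))
      · exact Or.inr hy
    rw [← continuousOn_univ, ← hunion]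
    exact h_on.union_of_isOpen h_off hO (isClosed_tsupport χA).isOpen_compl
  have hAext_K : ∀ y ∈ K, Aext y = A y := fun y hy => by
    simp [hAext, hχA1 hy]
  -- S3: holonomic approximation near the wiggled core
  have hint : ∀ y ∈ C, y ∈ interior K := fun y hy =>
    mem_interior_iff_mem_nhds.2 (mem_of_superset ((isOpen_thickening).mem_nhds
      (self_subset_thickening (by positivity) C hy)) hCK)
  have hOfit : IsOpen (W ∩ interior K) := hW.inter isOpen_interior
  obtain ⟨N, δ₁, hN, hδ₁, hδ₁ρ, gt, Ω, hgt, hΩ, hcoreΩ, hest, ⟨r, hr, hleft⟩, ⟨r', hr', hright⟩⟩ :=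
    holonomicApproximation_segment (F := 𝔼₂) (F₀ := f) (F₁ := Aext) hf.continuous hAext_cont hf
      hOfit ⟨hUW h0, hint _ h0C⟩ ⟨hUW h1, hint _ h1C⟩
      (fun y hy => ⟨rfl, by rw [hhol y hy.1, hAext_K y (interior_subset hy.2)]⟩)
      (ε := ε₁ / 2) (δ := ρ / 8) (by positivity) (by positivity)
  have hN' : (0 : ℝ) < N := by exact_mod_cast hN
  -- S4: the wiggle, the shear and its partial versions
  set φ : ℝ → ℝ := wiggle N δ₁ with hφ
  have hφs : ContDiff ℝ ∞ φ := contDiff_wiggle N δ₁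
  have hφabs : ∀ t, |φ t| ≤ δ₁ := fun t => abs_wiggle_le N hδ₁.le t
  set hs : ℝ → 𝔼₂ → 𝔼₂ := fun s => shear (fun t => s * φ t) 0 1 with hhs
  have h01 : (0 : Fin (n + 2)) ≠ 1 := by simp
  have hhs_zero : ∀ s (y : 𝔼₂), hs s y 0 = y 0 := fun s y => shear_apply_fst _ h01 y
  have hhs_dist : ∀ s ∈ Icc (0 : ℝ) 1, ∀ y : 𝔼₂, dist (hs s y) y ≤ δ₁ := by
    intro s hs' y
    rw [dist_eq_norm, hhs, norm_shear_sub, abs_mul, abs_of_nonneg hs'.1]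
    calc s * |φ (y 0)| ≤ 1 * δ₁ := mul_le_mul hs'.2 (hφabs _) (abs_nonneg _) zero_le_one
      _ = δ₁ := one_mul _
  have hhs_one : hs 1 = shear φ 0 1 := by
    funext y
    simp [hhs, shear_apply]
  -- the end regions `E`, where the shear is the identity and `gt = f`
  set a : ℝ := min r (1 / (8 * N)) with ha
  set a' : ℝ := min r' (1 / (8 * N)) with ha'
  have hapos : 0 < a := lt_min hr (by positivity)
  have ha'pos : 0 < a' := lt_min hr' (by positivity)
  have hale : a ≤ 1 / (8 * N) := min_le_right _ _
  have ha'le : a' ≤ 1 / (8 * N) := min_le_right _ _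
  have har : a ≤ r := min_le_left _ _
  have ha'r : a' ≤ r' := min_le_left _ _
  set E : Set 𝔼₂ := {y | y 0 < a} ∪ {y | 1 - a' < y 0} with hE
  have hc0 : Continuous fun y : 𝔼₂ => y 0 := (EuclideanSpace.proj (0 : Fin (n + 2)) : 𝔼₂ →L[ℝ] ℝ).continuous
  have hE_open : IsOpen E := (isOpen_lt hc0 continuous_const).union (isOpen_lt continuous_const hc0)
  have h0E : coreLine n 0 ∈ E := Or.inl (by simp only [mem_setOf_eq, coreLine_apply_zero]; exact hapos)
  have h1E : coreLine n 1 ∈ E := Or.inr (by simp only [mem_setOf_eq, coreLine_apply_zero]; linarith)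
  have hφE : ∀ y ∈ E, φ (y 0) = 0 := by
    rintro y (hy | hy)
    · simp only [mem_setOf_eq] at hy
      exact wiggle_of_le hN δ₁ (by linarith)
    · simp only [mem_setOf_eq] at hy
      exact wiggle_of_ge hN δ₁ (by linarith)
  have hφ'E : ∀ y ∈ E, deriv φ (y 0) = 0 := by
    rintro y (hy | hy)
    · simp only [mem_setOf_eq] at hy
      exact deriv_wiggle_of_lt hN δ₁ (by linarith)
    · simp only [mem_setOf_eq] at hy
      exact deriv_wiggle_of_gt hN δ₁ (by linarith)
  have hhsE : ∀ s, ∀ y ∈ E, hs s y = y := fun s y hy => shear_eq_self (by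
    show s * φ (y 0) = 0
    rw [hφE y hy, mul_zero])
  have hgtE : ∀ y ∈ E, gt y = f y := by
    rintro y (hy | hy)
    · simp only [mem_setOf_eq] at hy
      exact hleft y (by linarith)
    · simp only [mem_setOf_eq] at hy
      exact hright y (by linarith)
  -- S5: the tube radius `κ`
  have hpre : IsOpen (shear φ 0 1 ⁻¹' Ω) := hΩ.preimage (continuous_shear (continuous_wiggle N δ₁) 0 1)
  have hCpre : C ⊆ shear φ 0 1 ⁻¹' Ω := by
    rintro _ ⟨s, hs', rfl⟩
    exact hcoreΩ s hs'
  obtain ⟨κb, hκb, hκbΩ⟩ := hCc.exists_cthickening_subset_open hpre hCpre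
  obtain ⟨κc, hκc, hκcE⟩ := exists_cthickening_inter_subset hU hUC hE_open h0E h1E
  set κ : ℝ := min (min κb κc) (ρ / 8) with hκ
  have hκpos : 0 < κ := lt_min (lt_min hκb hκc) (by positivity)
  have hκb' : κ ≤ κb := (min_le_left _ _).trans (min_le_left _ _)
  have hκc' : κ ≤ κc := (min_le_left _ _).trans (min_le_right _ _)
  have hκρ : κ ≤ ρ / 8 := min_le_right _ _
  have hTκΩ : ∀ y ∈ cthickening κ C, shear φ 0 1 y ∈ Ω := fun y hy =>
    hκbΩ (cthickening_mono hκb' C hy)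
  have hTκE : U ∩ cthickening κ C ⊆ E := fun y hy => hκcE ⟨hy.1, cthickening_mono hκc' C hy.2⟩
  have hTκK : ∀ s ∈ Icc (0 : ℝ) 1, ∀ y ∈ cthickening κ C, hs s y ∈ K := by
    intro s hs' y hy
    have hmem := mem_thickening_of_mem_cthickening_of_dist_le hκpos.le
      (by linarith : δ₁ < 2 * δ₁) hy (hhs_dist s hs' y)
    refine hCK (thickening_mono ?_ C hmem)
    linarith
  have hTκO : cthickening κ C ⊆ O := fun y hy => by
    have := hTκK 0 ⟨le_rfl, zero_le_one⟩ y hy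
    rw [show hs 0 y = y from shear_eq_self (by show 0 * φ (y 0) = 0; ring)] at this
    exact hKO this
  -- S6: nested cut-offs `χ ≺ μ ≺ λ`
  have hdisj : ∀ {p q : ℝ}, 0 < q → p < q →
      Disjoint (thickening q C)ᶜ (cthickening p C) := fun hq hpq =>
    disjoint_compl_left_iff_subset.2 (cthickening_subset_thickening' hq hpq C)
  obtain ⟨χ, hχs, hχ0, hχ1, hχ01⟩ := exists_contDiff_zero_one_of_isClosed
    (isOpen_thickening (δ := κ / 2) (E := C)).isClosed_compl isClosed_cthickening
    (hdisj (by positivity) (by linarith) (p := κ / 4))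
  obtain ⟨μ, hμs, hμ0, hμ1, hμ01⟩ := exists_contDiff_zero_one_of_isClosed
    (isOpen_thickening (δ := 3 * κ / 4) (E := C)).isClosed_compl isClosed_cthickening
    (hdisj (by positivity) (by linarith) (p := κ / 2))
  obtain ⟨lam, hlams, hlam0, hlam1, hlam01⟩ := exists_contDiff_zero_one_of_isClosed
    (isOpen_thickening (δ := κ) (E := C)).isClosed_compl isClosed_cthickening
    (hdisj hκpos (by linarith) (p := 3 * κ / 4))
  -- support consequences
  have hχ_supp : ∀ y, χ y ≠ 0 → y ∈ thickening (κ / 2) C := fun y hy => by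
    by_contra h'; exact hy (hχ0 h')
  have hμ_supp : ∀ y, μ y ≠ 0 → y ∈ thickening (3 * κ / 4) C := fun y hy => by
    by_contra h'; exact hy (hμ0 h')
  have hlam_supp : ∀ y, lam y ≠ 0 → y ∈ thickening κ C := fun y hy => by
    by_contra h'; exact hy (hlam0 h')
  have hμ_of_χ : ∀ y, χ y ≠ 0 → μ y = 1 := fun y hy =>
    hμ1 (thickening_subset_cthickening _ _ (hχ_supp y hy))
  have hlam_of_μ : ∀ y, μ y ≠ 0 → lam y = 1 := fun y hy =>
    hlam1 (thickening_subset_cthickening _ _ (hμ_supp y hy))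
  have hlam_of_χ : ∀ y, χ y ≠ 0 → lam y = 1 := fun y hy => hlam_of_μ y (by
    rw [hμ_of_χ y hy]; exact one_ne_zero)
  -- S7: the new pair
  set gh : 𝔼₂ → 𝔼₂ := fun y => gt (shear φ 0 1 y) with hgh
  set g : 𝔼₂ → 𝔼₂ := fun y => f y + χ y • (gh y - f y) with hg
  set H : 𝔼₂ → 𝔼₂ := fun y => hs (lam y) y with hH
  set B : 𝔼₂ → 𝔼₂ →L[ℝ] 𝔼₂ := fun y =>
    (1 - μ y) • A (H y) + μ y • fderiv ℝ gt (H y) with hB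
  set A' : 𝔼₂ → 𝔼₂ →L[ℝ] 𝔼₂ := fun y => (B y).comp (shearFDeriv φ (lam y) y) with hA'
  set W' : Set 𝔼₂ := interior (cthickening (κ / 4) C) ∪ ((W ∩ E) ∪ (W ∩ (cthickening κ C)ᶜ))
    with hW'
  -- basic identities
  have hH_of_lam0 : ∀ y, lam y = 0 → H y = y := fun y hy =>
    shear_eq_self (by show lam y * φ (y 0) = 0; rw [hy, zero_mul])
  have hH_of_lam1 : ∀ y, lam y = 1 → H y = shear φ 0 1 y := fun y hy => by
    show hs (lam y) y = _
    rw [hy, hhs_one]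
  have hH_mem_O : ∀ y ∈ O, H y ∈ O := fun y hy => by
    by_cases hl : lam y = 0
    · rwa [hH_of_lam0 y hl]
    · exact hKO (hTκK (lam y) (hlam01 y) y (thickening_subset_cthickening _ _ (hlam_supp y hl)))
  have hH_cont : Continuous H := by
    show Continuous fun y => shear (fun t => lam y * φ t) 0 1 y
    simp only [shear_apply]
    exact continuous_id.add ((hlams.continuous.mul (hφs.continuous.comp hc0)).smul continuous_const)
  have hgh_smooth : ContDiff ℝ ∞ gh := hgt.comp (contDiff_shear hφs 0 1)
  have hg_smooth : ContDiff ℝ ∞ g := hf.add (hχs.smul (hgh_smooth.sub hf))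
  -- where things are trivial
  have hg_of_χ0 : ∀ y, χ y = 0 → g y = f y := fun y hy => by simp [hg, hy]
  have hB_of_zero : ∀ y, μ y = 0 → B y = A (H y) := fun y hm => by
    ext v
    simp [hB, hm]
  have hA'_of_zero : ∀ y, lam y = 0 → μ y = 0 → A' y = A y := fun y hl hm => by
    show (B y).comp (shearFDeriv φ (lam y) y) = A y
    rw [hB_of_zero y hm, hH_of_lam0 y hl, shearFDeriv_of_mul_eq_zero (by rw [hl, zero_mul]),
      ContinuousLinearMap.comp_id]
  refine ⟨g, A', W', hg_smooth, ?_, ?_, ?_, ?_, ?_, ?_, ?_⟩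
  · -- continuity of `A'` on `O`
    have hAH : ContinuousOn (fun y => A (H y)) O := hA.comp hH_cont.continuousOn hH_mem_O
    have hB_cont : ContinuousOn B O :=
      ((continuous_const.sub hμs.continuous).continuousOn.smul hAH).add
        (hμs.continuous.continuousOn.smul
          ((hgt.continuous_fderiv (by simp)).comp_continuousOn hH_cont.continuousOn))
    have hS_cont : Continuous fun y => shearFDeriv φ (lam y) y :=
      (continuous_shearFDeriv hφs).comp (hlams.continuous.prodMk continuous_id)
    exact hB_cont.clm_comp hS_cont.continuousOn
  · -- invertibility of `A' y`, `y ∈ O`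
    intro y hy
    have hS := isInvertible_shearFDeriv φ (lam y) y
    suffices hBinv : (B y).IsInvertible from hBinv.comp hS
    by_cases hm : μ y = 0
    · rw [hB_of_zero y hm]
      exact hinv _ (hH_mem_O y hy)
    · have hl : lam y = 1 := hlam_of_μ y hm
      have hHy : H y = shear φ 0 1 y := hH_of_lam1 y hl
      have hyT : y ∈ cthickening κ C :=
        cthickening_mono (by linarith) C (thickening_subset_cthickening _ _ (hμ_supp y hm))
      have hHK : H y ∈ K := by
        rw [hHy, ← hhs_one]
        exact hTκK 1 ⟨zero_le_one, le_rfl⟩ y hyT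
      have hHΩ : H y ∈ Ω := hHy ▸ hTκΩ y hyT
      have hclose : ‖fderiv ℝ gt (H y) - A (H y)‖ < ε₁ / 2 := by
        have := (hest _ hHΩ).2
        rwa [hAext_K _ hHK] at this
      refine hmargin (H y) hHK (B y) ?_
      have hsplit : B y - A (H y) = μ y • (fderiv ℝ gt (H y) - A (H y)) := by
        refine ContinuousLinearMap.ext fun v => ?_
        show ((1 - μ y) • A (H y) v + μ y • fderiv ℝ gt (H y) v) - A (H y) v =
          μ y • (fderiv ℝ gt (H y) v - A (H y) v)
        module
      rw [hsplit, norm_smul, Real.norm_of_nonneg (hμ01 y).1]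
      calc μ y * ‖fderiv ℝ gt (H y) - A (H y)‖ ≤ 1 * (ε₁ / 2) :=
            mul_le_mul (hμ01 y).2 hclose.le (norm_nonneg _) zero_le_one
        _ < ε₁ := by linarith
  · -- `W'` is open
    exact isOpen_interior.union ((hW.inter hE_open).union (hW.inter isClosed_cthickening.isOpen_compl))
  · -- `U ∪ C ⊆ W'`
    rintro y (hyU | hyC)
    · by_cases hyT : y ∈ cthickening κ C
      · exact Or.inr (Or.inl ⟨hUW hyU, hTκE ⟨hyU, hyT⟩⟩)
      · exact Or.inr (Or.inr ⟨hUW hyU, hyT⟩)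
    · refine Or.inl (mem_interior_iff_mem_nhds.2 (mem_of_superset
        ((isOpen_thickening).mem_nhds (self_subset_thickening (by positivity) C hyC))
        (thickening_subset_cthickening (κ / 4) C)))
  · -- `W' ⊆ O`
    rintro y (hy | ⟨hy, -⟩ | ⟨hy, -⟩)
    · exact hTκO (cthickening_mono (by linarith) C (interior_subset hy))
    · exact hWO hy
    · exact hWO hy
  · -- holonomy on `W'`
    rintro y (hy | ⟨hyW, hyE⟩ | ⟨hyW, hyT⟩)
    · -- near the core: `g = ĝ` near `y`, `A' = D ĝ`
      have hχ_near : ∀ᶠ z in 𝓝 y, χ z = 1 := by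
        filter_upwards [isOpen_interior.mem_nhds hy] with z hz
        exact hχ1 (interior_subset hz)
      have hgev : g =ᶠ[𝓝 y] gh := by
        filter_upwards [hχ_near] with z hz
        simp [hg, hz]
      rw [hgev.fderiv_eq]
      have hyκ4 : y ∈ cthickening (κ / 4) C := interior_subset hy
      have hχy : χ y = 1 := hχ1 hyκ4
      have hly : lam y = 1 := hlam_of_χ y (by rw [hχy]; exact one_ne_zero)
      have hmy : μ y = 1 := hμ_of_χ y (by rw [hχy]; exact one_ne_zero)
      -- chain rule for `ĝ = gt ∘ shear φ`
      have hchain : HasFDerivAt gh ((fderiv ℝ gt (shear φ 0 1 y)).comp (shearFDeriv φ 1 y)) y := by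
        have h1 := hasFDerivAt_shear_smul hφs 1 y
        have hfun : (fun t => (1 : ℝ) * φ t) = φ := by funext t; ring
        rw [hfun] at h1
        exact ((hgt.differentiable (by simp)) _).hasFDerivAt.comp y h1
      rw [hchain.fderiv]
      have hBy : B y = fderiv ℝ gt (shear φ 0 1 y) := by
        ext v
        simp [hB, hmy, hH_of_lam1 y hly]
      show _ = (B y).comp (shearFDeriv φ (lam y) y)
      rw [hly, hBy]
    · -- in the end regions: everything is the identity, `g = f`, `A' = A`
      have hgev : g =ᶠ[𝓝 y] f := by
        filter_upwards [hE_open.mem_nhds hyE] with z hz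
        have : gh z = f z := by
          show gt (shear φ 0 1 z) = f z
          rw [← hhs_one, hhsE 1 z hz, hgtE z hz]
        simp [hg, this]
      rw [hgev.fderiv_eq, hhol y hyW]
      have hHy : H y = y := hhsE (lam y) y hyE
      have hgtev : gt =ᶠ[𝓝 y] f := Filter.eventuallyEq_of_mem (hE_open.mem_nhds hyE) hgtE
      have hDgt : fderiv ℝ gt y = A y := by rw [hgtev.fderiv_eq, hhol y hyW]
      have hS : shearFDeriv φ (lam y) y = ContinuousLinearMap.id ℝ _ :=
        shearFDeriv_of_mul_eq_zero (by rw [hφ'E y hyE, mul_zero])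
      have hBy : B y = A y := by
        refine ContinuousLinearMap.ext fun v => ?_
        show (1 - μ y) • A (H y) v + μ y • fderiv ℝ gt (H y) v = A y v
        rw [hHy, hDgt]
        module
      show A y = (B y).comp (shearFDeriv φ (lam y) y)
      rw [hS, ContinuousLinearMap.comp_id, hBy]
    · -- off the tube: `g = f`, `A' = A`
      have hopen : IsOpen (cthickening κ C)ᶜ := isClosed_cthickening.isOpen_compl
      have hzero : ∀ z ∈ (cthickening κ C)ᶜ, χ z = 0 ∧ μ z = 0 ∧ lam z = 0 := by
        intro z hz
        refine ⟨?_, ?_, ?_⟩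
        · by_contra h'; exact hz (cthickening_mono (by linarith) C
            (thickening_subset_cthickening _ _ (hχ_supp z h')))
        · by_contra h'; exact hz (cthickening_mono (by linarith) C
            (thickening_subset_cthickening _ _ (hμ_supp z h')))
        · by_contra h'; exact hz (thickening_subset_cthickening _ _ (hlam_supp z h'))
      have hgev : g =ᶠ[𝓝 y] f := by
        filter_upwards [hopen.mem_nhds hyT] with z hz
        exact hg_of_χ0 z (hzero z hz).1
      rw [hgev.fderiv_eq, hhol y hyW, hA'_of_zero y (hzero y hyT).2.2 (hzero y hyT).2.1]
  · -- off the `ρ`-tube nothing changed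
    intro y hy
    have hyT : y ∉ cthickening κ C := fun h' => hy (hKρ (by
      exact (cthickening_mono (by linarith) C) h'))
    have hχy : χ y = 0 := by
      by_contra h'; exact hyT (cthickening_mono (by linarith) C
        (thickening_subset_cthickening _ _ (hχ_supp y h')))
    have hμy : μ y = 0 := by
      by_contra h'; exact hyT (cthickening_mono (by linarith) C
        (thickening_subset_cthickening _ _ (hμ_supp y h')))
    have hly : lam y = 0 := by
      by_contra h'; exact hyT (thickening_subset_cthickening _ _ (hlam_supp y h'))
    exact ⟨hg_of_χ0 y hχy, hA'_of_zero y hly hμy⟩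

end Literature.Topology.Immersions
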